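import Mathlib
import Summits.QuantumFields.YangMills.Theorems.CoarseStiffnessTailHistoryTailOfStiffness

/-!
# Route `CoarseStiffnessTail` — THE LINE'S LEVER WITHOUT ANY SMALL-FIELD CONTENT, file 1 of 2: the LARGE-FIELD COUNT of a level, its
# domination by the capped stiffness, and «count exponential moment ⇔ joint Peierls bound for every subfamily» (lead's certificate, seat
# `ym-line-cst-p1` g5; helper on crux stmt-QuantumFields-25301)

THE POINT.  Along route `CoarseStiffnessTail` the parent crux `UnitScaleTilt.HistoryTailL` (stmt-QuantumFields-19936) is reached by a chessboard
estimate followed by an exponential Chebyshev bound on the JOINT large-plaquette event of a chessboard family `S` (glue 25302, p608186;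
logarithmic variant p633005).  On that event the tilting observable is only evaluated THROUGH THE WINDOW EDGE: each `q ∈ S` has
`dist1(Ū^j(∂q)) ≥ θ(K−j)`.  Hence the whole sub-threshold part of the capped stiffness `X_j = Σ_a min(|Ū^j(∂a) − 1|², θ(K−j)²)` — the small-field
FLUCTUATION content which g3's certificate (p628112) showed the typed crux `CappedCoarseStiffnessL` (stmt-QuantumFields-25301) to carry at every
intermediate deviation — is idle for the glue.  What the glue consumes is the exponential moment of the LARGE-FIELD COUNT

  `N_j(U) := #{a ∈ Plaq_j : θ(K−j) ≤ |Ū^j(∂a) − 1|}`   (written `Σ_a 1[θ(K−j) ≤ dist1(Ū^j(∂a))]` throughout),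

i.e. the hypothesis LargeFieldCount of the companion file `…LargeFieldCountGlue` (constants per `(F, γ)`, logarithmic allowance as in p633005):
`∫ exp(c₀·p(g_{K−j})²·N_j) dGibbs_K ≤ exp((C₀ + A·log β_{K−j})·#Plaq_j)` — the law tilted by `e^{c₀p(g)²}` PER LARGE PLAQUETTE and `1` per small one
has free energy `O(1) + O(log β)` per level-`j` plaquette.  THIS FILE (definition-free, pure measure theory and finite combinatorics):

* §1 the count: measurable, `0 ≤ N_j ≤ #Plaq_j`, `≥ |S|` on the joint event of `S`, and **`sq_mul_count_le_capSum`**: pointwise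
  `(βθ²)·N_j ≤ β·X_j` — a large plaquette contributes `θ²` to `X_j`, a small one `≥ 0`;
* §2 **`integral_exp_count_le`**: with `β_{K−j}θ(K−j)² = p(g_{K−j})²` (`beta_mul_θBal_sq`) every capped-stiffness bound (the crux, LogStiffness,
  the bare face) implies the count bound with the SAME constants;
* §3 **`jointPeierls_of_count`** / **`integral_exp_count_le_of_jointPeierls`**: for one cut-off, height and threshold, `∫e^{tN_j} ≤ B` is
  EQUIVALENT (up to `t ↦ s ≤ t`, `B ↦ B·2^{#Plaq_j}`) to the JOINT PEIERLS BOUND `Gibbs_K{∀ a ∈ S: θ ≤ |Ū^j(∂a) − 1|} ≤ B·e^{−t|S|}` for EVERY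
  finite family `S` of level-`j` plaquettes — exponential Chebyshev one way; the product expansion `e^{sN} = Σ_S (e^s − 1)^{|S|}·1[S all large]`
  (`Finset.prod_one_add`), term-wise integration and the binomial sum `Finset.sum_pow_mul_eq_add_pow` the other way.

READING (for planners; nothing here is a claim about Bałaban's estimates).  In the count currency the lever of this line is LITERALLY the
integrated form of [Balaban1985UV3] (71) p.273 / [Balaban1989LargeFieldII] §0 (0.10)–(0.12): «a small factor `e^{−¼p(g_j)²}` for every plaquette
of every large-field set», summed against an `e^{O(1)|T^{(j)}|}` allowance — with NO two-sided small-field density bound, NO quadratic form of the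
effective action and NO exact normalisation.  By §3 it is the joint Peierls bound for ALL subfamilies with rate `c₀p(g)²` and prefactor
`e^{(C₀ + A log β)#Plaq_j}`; the owner's registered `Cruxes.HistoryTailL.BirthV5q.stub_jointRateHigh` on 19936 is the same located content for
DILUTE families with constants uniform in `(F, γ)` and slack `C·x_j·N_j³` — the two lines meet here.

HONEST SCOPE.  NOTHING of Bałaban's estimates is proved; the crux 25301 and `HistoryTailL` 19936 stay OPEN; `YM3TorusSU2` (rung R3, a RECORD rung,
not the Clay statement) is NOT proved; the Yang–Mills mass gap is NOT touched.

References: J. Fröhlich, R. Israel, E. Lieb, B. Simon, CMP **62** (1978) 1–34 [FrohlichIsraelLiebSimon1978] (Thm 4.1); T. Bałaban, CMP **102**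
(1985) 255–275 [Balaban1985UV3] ((7) p.257, (71) p.273); CMP **122** (1989) 355–392 [Balaban1989LargeFieldII] (§0 (0.10)–(0.12)).
-/

noncomputable section

namespace Summit.QuantumFields.YangMills.Theorems.CoarseStiffnessTailLargeFieldCount

open MeasureTheory ProbabilityTheory Finset
open Literature.MathematicalPhysics.QuantumFieldTheory
open Literature.MathematicalPhysics.QuantumFieldTheory.Balaban1983to89
open Literature.MathematicalPhysics.QuantumFieldTheory.Balaban1983to89.T3ContinuumYM3Torus
open Literature.MathematicalPhysics.QuantumFieldTheory.Balaban1983to89.T3UnitScaleTilt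
open Literature.MathematicalPhysics.QuantumFieldTheory.Balaban1983to89.T3UnitLawDensityEML
open Literature.MathematicalPhysics.QuantumFieldTheory.Balaban1983to89.T3FinestHeightTail (beta_mul_θBal_sq)
open Literature.MathematicalPhysics.QuantumFieldTheory.Balaban1983to89.T3MinimiserStabilityReduction (θBal_pos)
open Summit.QuantumFields.YangMills.Theorems.LargeFieldMassRefinementTailSubGaussianRung (measurable_dist1_iter)
open Summit.QuantumFields.YangMills.Theorems.CoarseStiffnessTailHistoryTailOfStiffness (measurable_capSum capSum_mem)

/-! ## §1 The large-field count of a level and its elementary properties -/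

section Count

variable (F : T3Family)

/-- The large-field count `N_j(U) = Σ_{a ∈ Plaq_j} 1[θ ≤ |Ū^j(∂a) − 1|]` is measurable. [folklore] -/
theorem measurable_count (K j : ℕ) (θ : ℝ) :
    Measurable fun U : GaugeField (F.P K) 0 (Matrix.specialUnitaryGroup (Fin 2) ℂ) =>
      ∑ a : Plaq (F.P K) j, (if θ ≤ GaugeGroup.dist1 (GaugeField.plaqHol
        (Averaging.iter (fun i => BlockAveraging.blockAvg (P := F.P K) (j := i) ℰp) j U) a) then (1 : ℝ) else 0) := by
  refine Finset.measurable_sum _ fun a _ => ?_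
  exact Measurable.ite (measurableSet_le measurable_const (measurable_dist1_iter F K j a)) measurable_const measurable_const

/-- `0 ≤ N_j(U) ≤ #Plaq_j`. [folklore] -/
theorem count_mem (K j : ℕ) (θ : ℝ) (U : GaugeField (F.P K) 0 (Matrix.specialUnitaryGroup (Fin 2) ℂ)) :
    0 ≤ ∑ a : Plaq (F.P K) j, (if θ ≤ GaugeGroup.dist1 (GaugeField.plaqHol
        (Averaging.iter (fun i => BlockAveraging.blockAvg (P := F.P K) (j := i) ℰp) j U) a) then (1 : ℝ) else 0) ∧
    ∑ a : Plaq (F.P K) j, (if θ ≤ GaugeGroup.dist1 (GaugeField.plaqHol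
        (Averaging.iter (fun i => BlockAveraging.blockAvg (P := F.P K) (j := i) ℰp) j U) a) then (1 : ℝ) else 0) ≤
      (Fintype.card (Plaq (F.P K) j) : ℝ) := by
  constructor
  · exact Finset.sum_nonneg fun a _ => by split_ifs <;> norm_num
  · calc ∑ a : Plaq (F.P K) j, (if θ ≤ GaugeGroup.dist1 (GaugeField.plaqHol
          (Averaging.iter (fun i => BlockAveraging.blockAvg (P := F.P K) (j := i) ℰp) j U) a) then (1 : ℝ) else 0)
        ≤ ∑ _a : Plaq (F.P K) j, (1 : ℝ) := Finset.sum_le_sum fun a _ => by split_ifs <;> norm_num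
      _ = (Fintype.card (Plaq (F.P K) j) : ℝ) := by rw [Finset.sum_const, Finset.card_univ, nsmul_eq_mul, mul_one]

/-- On the joint event `{∀ q ∈ S, θ ≤ |Ū^j(∂q) − 1|}` the count is at least `|S|`. [folklore] -/
theorem card_le_count (K j : ℕ) (θ : ℝ) (S : Finset (Plaq (F.P K) j))
    (U : GaugeField (F.P K) 0 (Matrix.specialUnitaryGroup (Fin 2) ℂ))
    (hU : ∀ q ∈ S, θ ≤ GaugeGroup.dist1 (GaugeField.plaqHol
        (Averaging.iter (fun i => BlockAveraging.blockAvg (P := F.P K) (j := i) ℰp) j U) q)) :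
    (S.card : ℝ) ≤ ∑ a : Plaq (F.P K) j, (if θ ≤ GaugeGroup.dist1 (GaugeField.plaqHol
        (Averaging.iter (fun i => BlockAveraging.blockAvg (P := F.P K) (j := i) ℰp) j U) a) then (1 : ℝ) else 0) := by
  calc (S.card : ℝ) = ∑ _q ∈ S, (1 : ℝ) := by rw [Finset.sum_const, nsmul_eq_mul, mul_one]
    _ ≤ ∑ q ∈ S, (if θ ≤ GaugeGroup.dist1 (GaugeField.plaqHol
        (Averaging.iter (fun i => BlockAveraging.blockAvg (P := F.P K) (j := i) ℰp) j U) q) then (1 : ℝ) else 0) :=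
        Finset.sum_le_sum fun q hq => by rw [if_pos (hU q hq)]
    _ ≤ ∑ a : Plaq (F.P K) j, (if θ ≤ GaugeGroup.dist1 (GaugeField.plaqHol
        (Averaging.iter (fun i => BlockAveraging.blockAvg (P := F.P K) (j := i) ℰp) j U) a) then (1 : ℝ) else 0) :=
        Finset.sum_le_sum_of_subset_of_nonneg (Finset.subset_univ S) fun a _ _ => by split_ifs <;> norm_num

/-- **THE COUNT IS THE EDGE PART OF THE CAPPED STIFFNESS**: pointwise `(βθ²)·N_j(U) ≤ β·X_j(U)` for `0 ≤ θ`, `0 ≤ β` — a large plaquette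
contributes `min(d², θ²) = θ²` to `X_j`, a small one contributes `≥ 0`. [folklore] -/
theorem sq_mul_count_le_capSum (K j : ℕ) {θ β : ℝ} (hθ : 0 ≤ θ) (hβ : 0 ≤ β)
    (U : GaugeField (F.P K) 0 (Matrix.specialUnitaryGroup (Fin 2) ℂ)) :
    β * θ ^ 2 * ∑ a : Plaq (F.P K) j, (if θ ≤ GaugeGroup.dist1 (GaugeField.plaqHol
        (Averaging.iter (fun i => BlockAveraging.blockAvg (P := F.P K) (j := i) ℰp) j U) a) then (1 : ℝ) else 0) ≤
      β * ∑ a : Plaq (F.P K) j, min (GaugeGroup.dist1 (GaugeField.plaqHol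
        (Averaging.iter (fun i => BlockAveraging.blockAvg (P := F.P K) (j := i) ℰp) j U) a) ^ 2) (θ ^ 2) := by
  rw [mul_assoc, Finset.mul_sum, Finset.mul_sum, Finset.mul_sum]
  refine Finset.sum_le_sum fun a _ => ?_
  refine mul_le_mul_of_nonneg_left ?_ hβ
  split_ifs with h
  · rw [mul_one]
    exact le_min (pow_le_pow_left₀ hθ h 2) le_rfl
  · rw [mul_zero]
    exact le_min (sq_nonneg _) (sq_nonneg _)

end Count

/-! ## §2 Every capped-stiffness bound implies the count bound with the same constants -/

section Domination

variable (F : T3Family)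

/-- **CAPPED STIFFNESS DOMINATES THE COUNT** (one family, one coupling `γ > 0`, `0 < b₀`, `0 ≤ c₀`, one cut-off `K`, one height `j`):
`∫ exp(c₀·p(g_{K−j})²·N_j) dGibbs_K ≤ ∫ exp(c₀·β_{K−j}·X_j) dGibbs_K` — §1 with `β_{K−j}θ(K−j)² = p(g_{K−j})²` (`beta_mul_θBal_sq`); the larger
integrand is bounded, hence integrable. [cite: Balaban1985UV3, (7) p.257] -/
theorem integral_exp_count_le {γ b₀ p₀ c₀ : ℝ} (hγ : 0 < γ) (hγ1 : γ ≤ 1) (hb₀ : 0 < b₀) (hc₀ : 0 ≤ c₀) (K j : ℕ) :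
    ∫ U, Real.exp (c₀ * B10.pFun b₀ p₀ (Real.sqrt (γ * ((F.L : ℝ)⁻¹) ^ (K - j))) ^ 2 *
        ∑ a : Plaq (F.P K) j, (if θBal F.L γ b₀ p₀ (K - j) ≤ GaugeGroup.dist1 (GaugeField.plaqHol
          (Averaging.iter (fun i => BlockAveraging.blockAvg (P := F.P K) (j := i) ℰp) j U) a) then (1 : ℝ) else 0))
        ∂(gibbsK F ℰp γ K) ≤
      ∫ U, Real.exp (c₀ * (γ * ((F.L : ℝ)⁻¹) ^ (K - j))⁻¹ *
        ∑ a : Plaq (F.P K) j, min (GaugeGroup.dist1 (GaugeField.plaqHol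
          (Averaging.iter (fun i => BlockAveraging.blockAvg (P := F.P K) (j := i) ℰp) j U) a) ^ 2)
          (θBal F.L γ b₀ p₀ (K - j) ^ 2)) ∂(gibbsK F ℰp γ K) := by
  haveI := isProbabilityMeasure_gibbsK F ℰp hγ.le K
  have hL : 1 ≤ F.L := F.hL.2.le
  set θ : ℝ := θBal F.L γ b₀ p₀ (K - j) with hθdef
  have hθ0 : 0 < θ := θBal_pos hL hγ hγ1 hb₀ p₀ (K - j)
  set β : ℝ := (γ * ((F.L : ℝ)⁻¹) ^ (K - j))⁻¹ with hβdef
  have hβ0 : 0 < β := by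
    have hL0 : (0 : ℝ) < F.L := by exact_mod_cast (zero_lt_one.trans F.hL.2)
    exact inv_pos.mpr (mul_pos hγ (pow_pos (inv_pos.mpr hL0) _))
  have hβeq : (F.scheme ℰp γ).β (K - j) = β := rfl
  have hp2 : B10.pFun b₀ p₀ (Real.sqrt (γ * ((F.L : ℝ)⁻¹) ^ (K - j))) ^ 2 = β * θ ^ 2 := by
    rw [← hβeq, hθdef, beta_mul_θBal_sq F hγ b₀ p₀ (K - j)]
  -- integrability of the capped-stiffness integrand (bounded on a probability space)
  have hint : Integrable (fun U => Real.exp (c₀ * β * ∑ a : Plaq (F.P K) j, min (GaugeGroup.dist1 (GaugeField.plaqHol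
      (Averaging.iter (fun i => BlockAveraging.blockAvg (P := F.P K) (j := i) ℰp) j U) a) ^ 2) (θ ^ 2))) (gibbsK F ℰp γ K) := by
    have hmeas : Measurable fun U => Real.exp (c₀ * β * ∑ a : Plaq (F.P K) j, min (GaugeGroup.dist1 (GaugeField.plaqHol
        (Averaging.iter (fun i => BlockAveraging.blockAvg (P := F.P K) (j := i) ℰp) j U) a) ^ 2) (θ ^ 2)) :=
      Real.measurable_exp.comp ((measurable_capSum F K j θ).const_mul (c₀ * β))
    refine (integrable_const (Real.exp (c₀ * β * ((Fintype.card (Plaq (F.P K) j) : ℝ) * θ ^ 2)))).mono'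
      hmeas.aestronglyMeasurable (ae_of_all _ fun U => ?_)
    rw [Real.norm_eq_abs, abs_of_pos (Real.exp_pos _)]
    exact Real.exp_le_exp.mpr (mul_le_mul_of_nonneg_left (capSum_mem F K j θ U).2 (mul_nonneg hc₀ hβ0.le))
  refine integral_mono_of_nonneg (ae_of_all _ fun U => (Real.exp_pos _).le) hint (ae_of_all _ fun U => ?_)
  refine Real.exp_le_exp.mpr ?_
  rw [hp2]
  have h := mul_le_mul_of_nonneg_left (sq_mul_count_le_capSum F K j hθ0.le hβ0.le U) hc₀
  linarith

end Domination

/-! ## §3 One cut-off, one height: count exponential moment ⇔ joint Peierls bound for every subfamily -/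

section Peierls

variable (F : T3Family)

/-- The joint large-plaquette event of a finite family is measurable. [folklore] -/
theorem measurableSet_joint (K j : ℕ) (θ : ℝ) (S : Finset (Plaq (F.P K) j)) :
    MeasurableSet {U : GaugeField (F.P K) 0 (Matrix.specialUnitaryGroup (Fin 2) ℂ) |
      ∀ q ∈ S, θ ≤ GaugeGroup.dist1 (GaugeField.plaqHol
        (Averaging.iter (fun i => BlockAveraging.blockAvg (P := F.P K) (j := i) ℰp) j U) q)} := by
  have : {U : GaugeField (F.P K) 0 (Matrix.specialUnitaryGroup (Fin 2) ℂ) |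
      ∀ q ∈ S, θ ≤ GaugeGroup.dist1 (GaugeField.plaqHol
        (Averaging.iter (fun i => BlockAveraging.blockAvg (P := F.P K) (j := i) ℰp) j U) q)} =
      ⋂ q ∈ S, {U | θ ≤ GaugeGroup.dist1 (GaugeField.plaqHol
        (Averaging.iter (fun i => BlockAveraging.blockAvg (P := F.P K) (j := i) ℰp) j U) q)} := by
    ext U; simp only [Set.mem_setOf_eq, Set.mem_iInter]
  rw [this]
  exact MeasurableSet.biInter (Set.to_countable _) fun q _ =>
    measurableSet_le measurable_const (measurable_dist1_iter F K j q)

/-- **COUNT MOMENT ⇒ JOINT PEIERLS** (one cut-off `K`, one height `j`, any threshold `θ`, `t ≥ 0`): if `∫ e^{t·N_j} dGibbs_K ≤ B` then for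
EVERY finite family `S` of level-`j` plaquettes `Gibbs_K{∀ q ∈ S: θ ≤ |Ū^j(∂q) − 1|} ≤ e^{−t|S|}·B` — exponential Chebyshev on `{|S| ≤ N_j}`.
[cite: FrohlichIsraelLiebSimon1978, Thm 4.1] -/
theorem jointPeierls_of_count {γ : ℝ} (hγ : 0 ≤ γ) (K j : ℕ) (θ : ℝ) {t B : ℝ} (ht : 0 ≤ t)
    (hN : ∫ U, Real.exp (t * ∑ a : Plaq (F.P K) j, (if θ ≤ GaugeGroup.dist1 (GaugeField.plaqHol
        (Averaging.iter (fun i => BlockAveraging.blockAvg (P := F.P K) (j := i) ℰp) j U) a) then (1 : ℝ) else 0))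
        ∂(gibbsK F ℰp γ K) ≤ B)
    (S : Finset (Plaq (F.P K) j)) :
    (gibbsK F ℰp γ K).real {U | ∀ q ∈ S, θ ≤ GaugeGroup.dist1 (GaugeField.plaqHol
        (Averaging.iter (fun i => BlockAveraging.blockAvg (P := F.P K) (j := i) ℰp) j U) q)} ≤
      Real.exp (-t * (S.card : ℝ)) * B := by
  haveI := isProbabilityMeasure_gibbsK F ℰp hγ K
  set N : GaugeField (F.P K) 0 (Matrix.specialUnitaryGroup (Fin 2) ℂ) → ℝ := fun U =>
    ∑ a : Plaq (F.P K) j, (if θ ≤ GaugeGroup.dist1 (GaugeField.plaqHol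
      (Averaging.iter (fun i => BlockAveraging.blockAvg (P := F.P K) (j := i) ℰp) j U) a) then (1 : ℝ) else 0) with hNdef
  have hsub : {U : GaugeField (F.P K) 0 (Matrix.specialUnitaryGroup (Fin 2) ℂ) |
        ∀ q ∈ S, θ ≤ GaugeGroup.dist1 (GaugeField.plaqHol
          (Averaging.iter (fun i => BlockAveraging.blockAvg (P := F.P K) (j := i) ℰp) j U) q)} ⊆
      {U | (S.card : ℝ) ≤ N U} := fun U hU => card_le_count F K j θ S U hU
  have hint : Integrable (fun U => Real.exp (t * N U)) (gibbsK F ℰp γ K) := by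
    have hmeas : Measurable fun U => Real.exp (t * N U) :=
      Real.measurable_exp.comp ((measurable_count F K j θ).const_mul t)
    refine (integrable_const (Real.exp (t * (Fintype.card (Plaq (F.P K) j) : ℝ)))).mono'
      hmeas.aestronglyMeasurable (ae_of_all _ fun U => ?_)
    rw [Real.norm_eq_abs, abs_of_pos (Real.exp_pos _)]
    exact Real.exp_le_exp.mpr (mul_le_mul_of_nonneg_left (count_mem F K j θ U).2 ht)
  have hmgf : mgf N (gibbsK F ℰp γ K) t ≤ B := by
    simp only [mgf]
    exact hN
  refine (measureReal_mono hsub).trans ?_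
  refine (measure_ge_le_exp_mul_mgf (S.card : ℝ) ht hint).trans ?_
  exact mul_le_mul_of_nonneg_left hmgf (Real.exp_pos _).le

/-- **JOINT PEIERLS ⇒ COUNT MOMENT** (one cut-off `K`, one height `j`, any threshold `θ`): if for EVERY finite family `S` of level-`j` plaquettes
`Gibbs_K{∀ q ∈ S: θ ≤ |Ū^j(∂q) − 1|} ≤ B·e^{−t|S|}`, then for every `0 ≤ s ≤ t`: `∫ e^{s·N_j} dGibbs_K ≤ B·2^{#Plaq_j}`.  Product expansion
`e^{sN} = Π_a (1 + (e^s − 1)·1[a large]) = Σ_S (e^s − 1)^{|S|}·1[S all large]` (`Finset.prod_one_add`), term-wise integration, and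
`Σ_S ((e^s − 1)e^{−t})^{|S|} = (1 + (e^s − 1)e^{−t})^{#Plaq_j} ≤ 2^{#Plaq_j}` since `(e^s − 1)e^{−t} ≤ 1`. [folklore] -/
theorem integral_exp_count_le_of_jointPeierls {γ : ℝ} (hγ : 0 ≤ γ) (K j : ℕ) (θ : ℝ) {s t B : ℝ} (hs : 0 ≤ s) (hst : s ≤ t)
    (hB : 0 ≤ B)
    (hP : ∀ S : Finset (Plaq (F.P K) j),
      (gibbsK F ℰp γ K).real {U | ∀ q ∈ S, θ ≤ GaugeGroup.dist1 (GaugeField.plaqHol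
        (Averaging.iter (fun i => BlockAveraging.blockAvg (P := F.P K) (j := i) ℰp) j U) q)} ≤
        B * Real.exp (-t * (S.card : ℝ))) :
    ∫ U, Real.exp (s * ∑ a : Plaq (F.P K) j, (if θ ≤ GaugeGroup.dist1 (GaugeField.plaqHol
        (Averaging.iter (fun i => BlockAveraging.blockAvg (P := F.P K) (j := i) ℰp) j U) a) then (1 : ℝ) else 0))
        ∂(gibbsK F ℰp γ K) ≤
      B * 2 ^ Fintype.card (Plaq (F.P K) j) := by
  classical
  haveI := isProbabilityMeasure_gibbsK F ℰp hγ K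
  -- abbreviations
  set d : Plaq (F.P K) j → GaugeField (F.P K) 0 (Matrix.specialUnitaryGroup (Fin 2) ℂ) → ℝ := fun a U =>
    GaugeGroup.dist1 (GaugeField.plaqHol (Averaging.iter (fun i => BlockAveraging.blockAvg (P := F.P K) (j := i) ℰp) j U) a)
    with hddef
  set x : ℝ := Real.exp s - 1 with hxdef
  have hx0 : 0 ≤ x := by rw [hxdef]; linarith [Real.one_le_exp hs]
  -- the product expansion of `e^{sN}`
  have hexpand : ∀ U : GaugeField (F.P K) 0 (Matrix.specialUnitaryGroup (Fin 2) ℂ),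
      Real.exp (s * ∑ a : Plaq (F.P K) j, (if θ ≤ d a U then (1 : ℝ) else 0)) =
        ∑ S ∈ (Finset.univ : Finset (Plaq (F.P K) j)).powerset,
          Set.indicator {V | ∀ q ∈ S, θ ≤ d q V} (fun _ => x ^ S.card) U := by
    intro U
    rw [Finset.mul_sum, Real.exp_sum]
    have hterm : ∀ a : Plaq (F.P K) j, Real.exp (s * (if θ ≤ d a U then (1 : ℝ) else 0)) =
        1 + (if θ ≤ d a U then x else 0) := by
      intro a
      split_ifs with h
      · rw [mul_one, hxdef]; ring
      · rw [mul_zero, Real.exp_zero, add_zero]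
    simp_rw [hterm]
    rw [Finset.prod_one_add]
    refine Finset.sum_congr rfl fun S _ => ?_
    by_cases hall : ∀ q ∈ S, θ ≤ d q U
    · rw [Set.indicator_of_mem (show U ∈ {V | ∀ q ∈ S, θ ≤ d q V} from hall)]
      rw [Finset.prod_congr rfl (fun a (ha : a ∈ S) => if_pos (hall a ha)), Finset.prod_const]
    · rw [Set.indicator_of_notMem (show U ∉ {V | ∀ q ∈ S, θ ≤ d q V} from hall)]
      push Not at hall
      obtain ⟨q, hqS, hq⟩ := hall
      exact Finset.prod_eq_zero hqS (if_neg (not_le.mpr hq))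
  -- integrate term by term
  have hmeasS : ∀ S : Finset (Plaq (F.P K) j), MeasurableSet {V : GaugeField (F.P K) 0 (Matrix.specialUnitaryGroup (Fin 2) ℂ) |
      ∀ q ∈ S, θ ≤ d q V} := fun S => measurableSet_joint F K j θ S
  have hintS : ∀ S ∈ (Finset.univ : Finset (Plaq (F.P K) j)).powerset,
      Integrable (fun U => Set.indicator {V | ∀ q ∈ S, θ ≤ d q V} (fun _ => x ^ S.card) U) (gibbsK F ℰp γ K) :=
    fun S _ => (integrable_const (x ^ S.card)).indicator (hmeasS S)
  have hval : ∀ S : Finset (Plaq (F.P K) j),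
      ∫ U, Set.indicator {V | ∀ q ∈ S, θ ≤ d q V} (fun _ => x ^ S.card) U ∂(gibbsK F ℰp γ K) =
        (gibbsK F ℰp γ K).real {V | ∀ q ∈ S, θ ≤ d q V} * x ^ S.card := by
    intro S
    rw [integral_indicator_const _ (hmeasS S), smul_eq_mul]
  calc ∫ U, Real.exp (s * ∑ a : Plaq (F.P K) j, (if θ ≤ d a U then (1 : ℝ) else 0)) ∂(gibbsK F ℰp γ K)
      = ∫ U, ∑ S ∈ (Finset.univ : Finset (Plaq (F.P K) j)).powerset,
          Set.indicator {V | ∀ q ∈ S, θ ≤ d q V} (fun _ => x ^ S.card) U ∂(gibbsK F ℰp γ K) := by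
        refine integral_congr_ae (ae_of_all _ fun U => ?_)
        exact hexpand U
    _ = ∑ S ∈ (Finset.univ : Finset (Plaq (F.P K) j)).powerset,
          (gibbsK F ℰp γ K).real {V | ∀ q ∈ S, θ ≤ d q V} * x ^ S.card := by
        rw [integral_finsetSum _ hintS]
        exact Finset.sum_congr rfl fun S _ => hval S
    _ ≤ ∑ S ∈ (Finset.univ : Finset (Plaq (F.P K) j)).powerset,
          B * ((x * Real.exp (-t)) ^ S.card * 1 ^ ((Finset.univ : Finset (Plaq (F.P K) j)).card - S.card)) := by
        refine Finset.sum_le_sum fun S _ => ?_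
        have hPS := hP S
        calc (gibbsK F ℰp γ K).real {V | ∀ q ∈ S, θ ≤ d q V} * x ^ S.card
            ≤ (B * Real.exp (-t * (S.card : ℝ))) * x ^ S.card :=
              mul_le_mul_of_nonneg_right hPS (pow_nonneg hx0 _)
          _ = B * ((x * Real.exp (-t)) ^ S.card * 1 ^ ((Finset.univ : Finset (Plaq (F.P K) j)).card - S.card)) := by
              rw [one_pow, mul_one, mul_pow, ← Real.exp_nat_mul, mul_assoc, mul_comm (Real.exp _)]
              congr 2
              ring_nf
    _ = B * (x * Real.exp (-t) + 1) ^ (Finset.univ : Finset (Plaq (F.P K) j)).card := by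
        rw [← Finset.mul_sum, Finset.sum_pow_mul_eq_add_pow]
    _ ≤ B * 2 ^ Fintype.card (Plaq (F.P K) j) := by
        rw [Finset.card_univ]
        refine mul_le_mul_of_nonneg_left ?_ hB
        have hx1 : x * Real.exp (-t) ≤ 1 := by
          have h1 : x ≤ Real.exp s := by rw [hxdef]; linarith
          have h2 : Real.exp s * Real.exp (-t) ≤ 1 := by
            rw [← Real.exp_add]
            exact Real.exp_le_one_iff.mpr (by linarith)
          exact (mul_le_mul_of_nonneg_right h1 (Real.exp_pos _).le).trans h2
        have hx2 : 0 ≤ x * Real.exp (-t) := mul_nonneg hx0 (Real.exp_pos _).le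
        calc (x * Real.exp (-t) + 1) ^ (Finset.univ : Finset (Plaq (F.P K) j)).card
            ≤ (1 + 1 : ℝ) ^ (Finset.univ : Finset (Plaq (F.P K) j)).card := by gcongr
          _ = 2 ^ Fintype.card (Plaq (F.P K) j) := by rw [Finset.card_univ]; norm_num

end Peierls

end Summit.QuantumFields.YangMills.Theorems.CoarseStiffnessTailLargeFieldCount

end
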